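import Summits.Ventures.CertifiedArithmetic.LowPrec.PatternEnvelopeMulModes
import Literature.ComputerArithmetic.FloatingPoint.Formats

/-!
# Pattern route of Theorem E5, part 3: the FP6/FP4 product constants recomputed WITHOUT
# operand-pair enumeration

HONEST FRAMING (venture CertifiedArithmetic / cell `pub-lowprec`): certified error envelopes and
provably optimal rounding/accumulation schemes for low-precision formats under stated cost models;
every table by two implementations; no hardware or vendor claims.

"Every table by two implementations", inside Lean: the kernel-exhaustive product tables of
`EnvelopesE2M1/E3M2/E2M3.lean`, `EnvelopesMixed*.lean` (nearest) and `EnvelopesDirected*.lean`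
(RZ / RD / RU) decide a predicate over ALL operand pairs (`16²` to `64²` per key); here the same
normal-range constants come out of the PATTERN ROUTE of `PatternEnvelopeMul.lean` — the maximum of
a closed-form significand-pattern error over the realisable-and-placeable patterns (THEOREMS-R1
Theorem E5; the third-route evaluator `code/enum/envconst.py`, pre-registered as
`certs/enum/PREDICTIONS-ENVCONST-FP6FP4*.json`) — by `decide` on pattern-level lists only.
For each of the nine FP6/FP4 product keys `X · Y → X` (OCP `E2M1`, `E3M2`, `E2M3`):
* `X_Y_mul_X_patternConstants`: the three constants (nearest, toward zero, round down = round up)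
  — they coincide with the literals of the kernel-exhaustive theorems
  `X_Y_mul_X_relRZ/RD/RU_normal` (`EnvelopesDirected*.lean`), which therefore also follow from
  `MiniFloat.mul_relTZ/RD/RU_normal_of_envconst` and are not restated;
* `X_Y_mul_X_relNE_pattern`: the NEAREST table theorem in the sharp shape (bound on the normal
  range over all operand pairs AND a maximiser), obtained from `mul_relNE_normal_of_envconst` —
  new in this shape for nearest (the `Envelopes*.lean` nearest theorems carry no maximiser
  clause for products on the normal range).
Constants (nearest, toward zero, directed): `E2M1·E2M1 → E2M1: 1/9, 1/9, 1/3`;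
`E2M1·E2M3 → E2M1: 1/5, 13/45, 5/11`; `E2M1·E3M2 → E2M1: 1/5, 5/21, 1/3`;
`E2M3·E2M1 → E2M3: 1/21, 1/13, 1/11`; `E2M3·E2M3 → E2M3: 7/135, 15/143, 7/65`;
`E2M3·E3M2 → E2M3: 1/21, 3/35, 7/65`; `E3M2·E2M1 → E3M2: 1/9, 1/9, 1/7`;
`E3M2·E2M3 → E3M2: 1/9, 7/39, 3/13`; `E3M2·E3M2 → E3M2: 1/9, 1/9, 1/7` — identical to
`envelope_constants_E5` of `certs/enum/THEOREMS-R1-FP6FP4MIXED.json` and to ENVELOPES.md.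
Wide destinations (`Binary16`, `BFloat16`, `Binary32`): the pattern constants vanish — shown for
the largest operand pair `E2M3 · E2M3` (`E2M3_E2M3_mul_*_patternConstants`), the pattern-level
shadow of `ExactWideFP6FP4.lean` (which covers every pair and the whole range).
FP8 keys are deliberately not instantiated here (cell rule: FP8 tables are held).

Placement: venture development under `Summits/Ventures/CertifiedArithmetic/` (operator decision,
BOARD.md); new work of the venture, elementary ([folklore]; format parameters
[cite: OCP-MX-v1.0, §5.3]).
-/

namespace Summit.Ventures.CertifiedArithmetic

open Literature.ComputerArithmetic.FloatingPoint
open Literature.ComputerArithmetic.FloatingPoint.Format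
open Literature.ComputerArithmetic.FloatingPoint.MiniFloat

/-- `E2M1 · E2M1 → E2M1`: the pattern-route constants — nearest `1/9`, toward zero
`1/9`, round down = round up `1/3` (THEOREMS-R1 Theorem E5; no operand-pair
enumeration). [folklore] -/
theorem E2M1_E2M1_mul_E2M1_patternConstants :
    envconstMulNE E2M1 E2M1 E2M1 = 1 / 9 ∧ envconstMulTZ E2M1 E2M1 E2M1 = 1 / 9 ∧
      envconstMulDir E2M1 E2M1 E2M1 = 1 / 3 := by
  decide +kernel

/-- `E2M1 · E2M1 → E2M1`, NEAREST, by the PATTERN ROUTE: on the normal range `1 ≤ |t| ≤ 6` of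
`E2M1` every product of data satisfies `|RNE(t) - t| ≤ 1/9 · |t|`, and the constant is attained.
[folklore] -/
theorem E2M1_E2M1_mul_E2M1_relNE_pattern :
    (∀ (a : MiniFloat E2M1) (b : MiniFloat E2M1),
        (1 : ℚ) ≤ |a.toRat * b.toRat| → |a.toRat * b.toRat| ≤ E2M1.maxRat →
          |(roundNE E2M1 (a.toRat * b.toRat)).toRat - a.toRat * b.toRat|
            ≤ 1 / 9 * |a.toRat * b.toRat|) ∧
      ∃ (a : MiniFloat E2M1) (b : MiniFloat E2M1),
        (1 : ℚ) ≤ |a.toRat * b.toRat| ∧ |a.toRat * b.toRat| ≤ E2M1.maxRat ∧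
          |(roundNE E2M1 (a.toRat * b.toRat)).toRat - a.toRat * b.toRat|
            = 1 / 9 * |a.toRat * b.toRat| :=
  mul_relNE_normal_of_envconst E2M1 (by decide +kernel) E2M1_E2M1_mul_E2M1_patternConstants.1
    (by decide +kernel)

/-- `E2M1 · E2M3 → E2M1`: the pattern-route constants — nearest `1/5`, toward zero
`13/45`, round down = round up `5/11` (THEOREMS-R1 Theorem E5; no operand-pair
enumeration). [folklore] -/
theorem E2M1_E2M3_mul_E2M1_patternConstants :
    envconstMulNE E2M1 E2M3 E2M1 = 1 / 5 ∧ envconstMulTZ E2M1 E2M3 E2M1 = 13 / 45 ∧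
      envconstMulDir E2M1 E2M3 E2M1 = 5 / 11 := by
  decide +kernel

/-- `E2M1 · E2M3 → E2M1`, NEAREST, by the PATTERN ROUTE: on the normal range `1 ≤ |t| ≤ 6` of
`E2M1` every product of data satisfies `|RNE(t) - t| ≤ 1/5 · |t|`, and the constant is attained.
[folklore] -/
theorem E2M1_E2M3_mul_E2M1_relNE_pattern :
    (∀ (a : MiniFloat E2M1) (b : MiniFloat E2M3),
        (1 : ℚ) ≤ |a.toRat * b.toRat| → |a.toRat * b.toRat| ≤ E2M1.maxRat →
          |(roundNE E2M1 (a.toRat * b.toRat)).toRat - a.toRat * b.toRat|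
            ≤ 1 / 5 * |a.toRat * b.toRat|) ∧
      ∃ (a : MiniFloat E2M1) (b : MiniFloat E2M3),
        (1 : ℚ) ≤ |a.toRat * b.toRat| ∧ |a.toRat * b.toRat| ≤ E2M1.maxRat ∧
          |(roundNE E2M1 (a.toRat * b.toRat)).toRat - a.toRat * b.toRat|
            = 1 / 5 * |a.toRat * b.toRat| :=
  mul_relNE_normal_of_envconst E2M1 (by decide +kernel) E2M1_E2M3_mul_E2M1_patternConstants.1
    (by decide +kernel)

/-- `E2M1 · E3M2 → E2M1`: the pattern-route constants — nearest `1/5`, toward zero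
`5/21`, round down = round up `1/3` (THEOREMS-R1 Theorem E5; no operand-pair
enumeration). [folklore] -/
theorem E2M1_E3M2_mul_E2M1_patternConstants :
    envconstMulNE E2M1 E3M2 E2M1 = 1 / 5 ∧ envconstMulTZ E2M1 E3M2 E2M1 = 5 / 21 ∧
      envconstMulDir E2M1 E3M2 E2M1 = 1 / 3 := by
  decide +kernel

/-- `E2M1 · E3M2 → E2M1`, NEAREST, by the PATTERN ROUTE: on the normal range `1 ≤ |t| ≤ 6` of
`E2M1` every product of data satisfies `|RNE(t) - t| ≤ 1/5 · |t|`, and the constant is attained.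
[folklore] -/
theorem E2M1_E3M2_mul_E2M1_relNE_pattern :
    (∀ (a : MiniFloat E2M1) (b : MiniFloat E3M2),
        (1 : ℚ) ≤ |a.toRat * b.toRat| → |a.toRat * b.toRat| ≤ E2M1.maxRat →
          |(roundNE E2M1 (a.toRat * b.toRat)).toRat - a.toRat * b.toRat|
            ≤ 1 / 5 * |a.toRat * b.toRat|) ∧
      ∃ (a : MiniFloat E2M1) (b : MiniFloat E3M2),
        (1 : ℚ) ≤ |a.toRat * b.toRat| ∧ |a.toRat * b.toRat| ≤ E2M1.maxRat ∧
          |(roundNE E2M1 (a.toRat * b.toRat)).toRat - a.toRat * b.toRat|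
            = 1 / 5 * |a.toRat * b.toRat| :=
  mul_relNE_normal_of_envconst E2M1 (by decide +kernel) E2M1_E3M2_mul_E2M1_patternConstants.1
    (by decide +kernel)

/-- `E2M3 · E2M1 → E2M3`: the pattern-route constants — nearest `1/21`, toward zero
`1/13`, round down = round up `1/11` (THEOREMS-R1 Theorem E5; no operand-pair
enumeration). [folklore] -/
theorem E2M3_E2M1_mul_E2M3_patternConstants :
    envconstMulNE E2M3 E2M1 E2M3 = 1 / 21 ∧ envconstMulTZ E2M3 E2M1 E2M3 = 1 / 13 ∧
      envconstMulDir E2M3 E2M1 E2M3 = 1 / 11 := by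
  decide +kernel

/-- `E2M3 · E2M1 → E2M3`, NEAREST, by the PATTERN ROUTE: on the normal range `1 ≤ |t| ≤ 15/2` of
`E2M3` every product of data satisfies `|RNE(t) - t| ≤ 1/21 · |t|`, and the constant is attained.
[folklore] -/
theorem E2M3_E2M1_mul_E2M3_relNE_pattern :
    (∀ (a : MiniFloat E2M3) (b : MiniFloat E2M1),
        (1 : ℚ) ≤ |a.toRat * b.toRat| → |a.toRat * b.toRat| ≤ E2M3.maxRat →
          |(roundNE E2M3 (a.toRat * b.toRat)).toRat - a.toRat * b.toRat|
            ≤ 1 / 21 * |a.toRat * b.toRat|) ∧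
      ∃ (a : MiniFloat E2M3) (b : MiniFloat E2M1),
        (1 : ℚ) ≤ |a.toRat * b.toRat| ∧ |a.toRat * b.toRat| ≤ E2M3.maxRat ∧
          |(roundNE E2M3 (a.toRat * b.toRat)).toRat - a.toRat * b.toRat|
            = 1 / 21 * |a.toRat * b.toRat| :=
  mul_relNE_normal_of_envconst E2M3 (by decide +kernel) E2M3_E2M1_mul_E2M3_patternConstants.1
    (by decide +kernel)

/-- `E2M3 · E2M3 → E2M3`: the pattern-route constants — nearest `7/135`, toward zero
`15/143`, round down = round up `7/65` (THEOREMS-R1 Theorem E5; no operand-pair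
enumeration). [folklore] -/
theorem E2M3_E2M3_mul_E2M3_patternConstants :
    envconstMulNE E2M3 E2M3 E2M3 = 7 / 135 ∧ envconstMulTZ E2M3 E2M3 E2M3 = 15 / 143 ∧
      envconstMulDir E2M3 E2M3 E2M3 = 7 / 65 := by
  decide +kernel

/-- `E2M3 · E2M3 → E2M3`, NEAREST, by the PATTERN ROUTE: on the normal range `1 ≤ |t| ≤ 15/2` of
`E2M3` every product of data satisfies `|RNE(t) - t| ≤ 7/135 · |t|`, and the constant is attained.
[folklore] -/
theorem E2M3_E2M3_mul_E2M3_relNE_pattern :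
    (∀ (a : MiniFloat E2M3) (b : MiniFloat E2M3),
        (1 : ℚ) ≤ |a.toRat * b.toRat| → |a.toRat * b.toRat| ≤ E2M3.maxRat →
          |(roundNE E2M3 (a.toRat * b.toRat)).toRat - a.toRat * b.toRat|
            ≤ 7 / 135 * |a.toRat * b.toRat|) ∧
      ∃ (a : MiniFloat E2M3) (b : MiniFloat E2M3),
        (1 : ℚ) ≤ |a.toRat * b.toRat| ∧ |a.toRat * b.toRat| ≤ E2M3.maxRat ∧
          |(roundNE E2M3 (a.toRat * b.toRat)).toRat - a.toRat * b.toRat|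
            = 7 / 135 * |a.toRat * b.toRat| :=
  mul_relNE_normal_of_envconst E2M3 (by decide +kernel) E2M3_E2M3_mul_E2M3_patternConstants.1
    (by decide +kernel)

/-- `E2M3 · E3M2 → E2M3`: the pattern-route constants — nearest `1/21`, toward zero
`3/35`, round down = round up `7/65` (THEOREMS-R1 Theorem E5; no operand-pair
enumeration). [folklore] -/
theorem E2M3_E3M2_mul_E2M3_patternConstants :
    envconstMulNE E2M3 E3M2 E2M3 = 1 / 21 ∧ envconstMulTZ E2M3 E3M2 E2M3 = 3 / 35 ∧
      envconstMulDir E2M3 E3M2 E2M3 = 7 / 65 := by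
  decide +kernel

/-- `E2M3 · E3M2 → E2M3`, NEAREST, by the PATTERN ROUTE: on the normal range `1 ≤ |t| ≤ 15/2` of
`E2M3` every product of data satisfies `|RNE(t) - t| ≤ 1/21 · |t|`, and the constant is attained.
[folklore] -/
theorem E2M3_E3M2_mul_E2M3_relNE_pattern :
    (∀ (a : MiniFloat E2M3) (b : MiniFloat E3M2),
        (1 : ℚ) ≤ |a.toRat * b.toRat| → |a.toRat * b.toRat| ≤ E2M3.maxRat →
          |(roundNE E2M3 (a.toRat * b.toRat)).toRat - a.toRat * b.toRat|
            ≤ 1 / 21 * |a.toRat * b.toRat|) ∧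
      ∃ (a : MiniFloat E2M3) (b : MiniFloat E3M2),
        (1 : ℚ) ≤ |a.toRat * b.toRat| ∧ |a.toRat * b.toRat| ≤ E2M3.maxRat ∧
          |(roundNE E2M3 (a.toRat * b.toRat)).toRat - a.toRat * b.toRat|
            = 1 / 21 * |a.toRat * b.toRat| :=
  mul_relNE_normal_of_envconst E2M3 (by decide +kernel) E2M3_E3M2_mul_E2M3_patternConstants.1
    (by decide +kernel)

/-- `E3M2 · E2M1 → E3M2`: the pattern-route constants — nearest `1/9`, toward zero
`1/9`, round down = round up `1/7` (THEOREMS-R1 Theorem E5; no operand-pair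
enumeration). [folklore] -/
theorem E3M2_E2M1_mul_E3M2_patternConstants :
    envconstMulNE E3M2 E2M1 E3M2 = 1 / 9 ∧ envconstMulTZ E3M2 E2M1 E3M2 = 1 / 9 ∧
      envconstMulDir E3M2 E2M1 E3M2 = 1 / 7 := by
  decide +kernel

/-- `E3M2 · E2M1 → E3M2`, NEAREST, by the PATTERN ROUTE: on the normal range `1/4 ≤ |t| ≤ 28` of
`E3M2` every product of data satisfies `|RNE(t) - t| ≤ 1/9 · |t|`, and the constant is attained.
[folklore] -/
theorem E3M2_E2M1_mul_E3M2_relNE_pattern :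
    (∀ (a : MiniFloat E3M2) (b : MiniFloat E2M1),
        (1 / 4 : ℚ) ≤ |a.toRat * b.toRat| → |a.toRat * b.toRat| ≤ E3M2.maxRat →
          |(roundNE E3M2 (a.toRat * b.toRat)).toRat - a.toRat * b.toRat|
            ≤ 1 / 9 * |a.toRat * b.toRat|) ∧
      ∃ (a : MiniFloat E3M2) (b : MiniFloat E2M1),
        (1 / 4 : ℚ) ≤ |a.toRat * b.toRat| ∧ |a.toRat * b.toRat| ≤ E3M2.maxRat ∧
          |(roundNE E3M2 (a.toRat * b.toRat)).toRat - a.toRat * b.toRat|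
            = 1 / 9 * |a.toRat * b.toRat| :=
  mul_relNE_normal_of_envconst E3M2 (by decide +kernel) E3M2_E2M1_mul_E3M2_patternConstants.1
    (by decide +kernel)

/-- `E3M2 · E2M3 → E3M2`: the pattern-route constants — nearest `1/9`, toward zero
`7/39`, round down = round up `3/13` (THEOREMS-R1 Theorem E5; no operand-pair
enumeration). [folklore] -/
theorem E3M2_E2M3_mul_E3M2_patternConstants :
    envconstMulNE E3M2 E2M3 E3M2 = 1 / 9 ∧ envconstMulTZ E3M2 E2M3 E3M2 = 7 / 39 ∧
      envconstMulDir E3M2 E2M3 E3M2 = 3 / 13 := by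
  decide +kernel

/-- `E3M2 · E2M3 → E3M2`, NEAREST, by the PATTERN ROUTE: on the normal range `1/4 ≤ |t| ≤ 28` of
`E3M2` every product of data satisfies `|RNE(t) - t| ≤ 1/9 · |t|`, and the constant is attained.
[folklore] -/
theorem E3M2_E2M3_mul_E3M2_relNE_pattern :
    (∀ (a : MiniFloat E3M2) (b : MiniFloat E2M3),
        (1 / 4 : ℚ) ≤ |a.toRat * b.toRat| → |a.toRat * b.toRat| ≤ E3M2.maxRat →
          |(roundNE E3M2 (a.toRat * b.toRat)).toRat - a.toRat * b.toRat|
            ≤ 1 / 9 * |a.toRat * b.toRat|) ∧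
      ∃ (a : MiniFloat E3M2) (b : MiniFloat E2M3),
        (1 / 4 : ℚ) ≤ |a.toRat * b.toRat| ∧ |a.toRat * b.toRat| ≤ E3M2.maxRat ∧
          |(roundNE E3M2 (a.toRat * b.toRat)).toRat - a.toRat * b.toRat|
            = 1 / 9 * |a.toRat * b.toRat| :=
  mul_relNE_normal_of_envconst E3M2 (by decide +kernel) E3M2_E2M3_mul_E3M2_patternConstants.1
    (by decide +kernel)

/-- `E3M2 · E3M2 → E3M2`: the pattern-route constants — nearest `1/9`, toward zero
`1/9`, round down = round up `1/7` (THEOREMS-R1 Theorem E5; no operand-pair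
enumeration). [folklore] -/
theorem E3M2_E3M2_mul_E3M2_patternConstants :
    envconstMulNE E3M2 E3M2 E3M2 = 1 / 9 ∧ envconstMulTZ E3M2 E3M2 E3M2 = 1 / 9 ∧
      envconstMulDir E3M2 E3M2 E3M2 = 1 / 7 := by
  decide +kernel

/-- `E3M2 · E3M2 → E3M2`, NEAREST, by the PATTERN ROUTE: on the normal range `1/4 ≤ |t| ≤ 28` of
`E3M2` every product of data satisfies `|RNE(t) - t| ≤ 1/9 · |t|`, and the constant is attained.
[folklore] -/
theorem E3M2_E3M2_mul_E3M2_relNE_pattern :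
    (∀ (a : MiniFloat E3M2) (b : MiniFloat E3M2),
        (1 / 4 : ℚ) ≤ |a.toRat * b.toRat| → |a.toRat * b.toRat| ≤ E3M2.maxRat →
          |(roundNE E3M2 (a.toRat * b.toRat)).toRat - a.toRat * b.toRat|
            ≤ 1 / 9 * |a.toRat * b.toRat|) ∧
      ∃ (a : MiniFloat E3M2) (b : MiniFloat E3M2),
        (1 / 4 : ℚ) ≤ |a.toRat * b.toRat| ∧ |a.toRat * b.toRat| ≤ E3M2.maxRat ∧
          |(roundNE E3M2 (a.toRat * b.toRat)).toRat - a.toRat * b.toRat|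
            = 1 / 9 * |a.toRat * b.toRat| :=
  mul_relNE_normal_of_envconst E3M2 (by decide +kernel) E3M2_E3M2_mul_E3M2_patternConstants.1
    (by decide +kernel)

/-- WIDE DESTINATION `Binary16`, largest FP6 operand pair `E2M3 · E2M3`: all three pattern
constants vanish (every placeable product pattern fits the significand of `Binary16`) — the
pattern-level shadow of `fp6fp4_products_exact_in_Binary16` (`ExactWideFP6FP4.lean`). [folklore] -/
theorem E2M3_E2M3_mul_Binary16_patternConstants :
    envconstMulNE E2M3 E2M3 Binary16 = 0 ∧ envconstMulTZ E2M3 E2M3 Binary16 = 0 ∧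
      envconstMulDir E2M3 E2M3 Binary16 = 0 := by
  decide +kernel

/-- WIDE DESTINATION `BFloat16`, `E2M3 · E2M3`: all three pattern constants vanish. [folklore] -/
theorem E2M3_E2M3_mul_BFloat16_patternConstants :
    envconstMulNE E2M3 E2M3 BFloat16 = 0 ∧ envconstMulTZ E2M3 E2M3 BFloat16 = 0 ∧
      envconstMulDir E2M3 E2M3 BFloat16 = 0 := by
  decide +kernel

/-- WIDE DESTINATION `Binary32`, `E2M3 · E2M3`: all three pattern constants vanish. [folklore] -/
theorem E2M3_E2M3_mul_Binary32_patternConstants :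
    envconstMulNE E2M3 E2M3 Binary32 = 0 ∧ envconstMulTZ E2M3 E2M3 Binary32 = 0 ∧
      envconstMulDir E2M3 E2M3 Binary32 = 0 := by
  decide +kernel

end Summit.Ventures.CertifiedArithmetic
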